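import Summits.QuantumFields.YangMills.Theorems.BalabanUVNodesN15CovariantAveragingTransportSizes
import Summits.QuantumFields.YangMills.Theorems.BalabanUVNodesN15TwoGridLocality
import HarnessLib

/-!
# Route «BalabanUVNodes», node N15 = NE2, road (c) — PROGRAMME (P-Q), IIb: THE LETTERS OF THE COVARIANT AVERAGING PAIR — `Q(U) − Q(1)` and `Q*(U) − Q*(1)` are
# BLOCK-LOCAL with size `(1+ρ)^{(d+2)n} − 1` once every one-bond transporter is `ρ`-close to `1` (rows AND columns), hence Bałaban's averaging summand dresses the flat
# `aQ*Q ⊗ 1_ι` by the block-local perturbation `N_V^Q = a(Q*(1)Q(1) − Q*(U)Q(U))` of block majorant `|a|·K(2+K)·c·e^{3δ}·e^{−δ d}`, `K = (1+ρ)^{(d+2)n} − 1`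

Cell `pub-ymgap`, seat `pub-ymgap-dag-n15-c` (generation g21; R134 (a) seat, strategy s1; HUMAN RULING D-0062; chair R424 venue).  `bears_on: R4∕N15 · K3⁸ SpineGivenEndpointR13SepCoPHV
(stmt-QuantumFields-27366)`; filed `--supports stmt-QuantumFields-27366 --as helper` — COUNT-NEUTRAL.  THEOREMS only ([folklore] matrix ∕ block-majorant bookkeeping), 0 `def`, 0 `sorry`.
Imports BY NAME, nothing in the tree modified ∕ restated: this seat's n15-c∕181 `…N15CovariantAveragingObjects` (`qvKer`∕`qvAdjKer`, `qvCov`∕`qvCovAdj`, `qvCov_one`∕`qvCovAdj_one`,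
`qvCov_sub_qvCov_one`∕`qvCovAdj_sub_qvCovAdj_one`) and n15-c∕182a `…N15CovariantAveragingTransportSizes` (`rows_cvaPath_sub_one_le`∕`cols_cvaPath_sub_one_le`∕`rows_cvaPath_le`∕`cols_cvaPath_le`), dag-n15-a `…N15TwoGridLocality` (`tdistT_blockOf_add_smul_le`, `hasMaj_smul_ofBlocks`), the
Literature's `B11SectG` (`HasMaj`, `hasMaj_comp_exp`, `HasMaj.add`), `B11AxialTransport190` (`abs_le_loc_ofBlocks`, `loc_ofBlocks_le`), `B6UnitTorusCarrier` (`unitTorusGeo`, `rowSum_unitTorusGeo`,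
`card_fibre_blockOf`), dag-n15-c M4 (`tensorId_comp`).

WHY.  In the global small-field gauge the cover knit (FILE 120 `uN_cvGlued_spec` ∕ 123 `uN_idef_cvGlued`) takes Bałaban's summand `P` with `P = N_L ⊗ 1 − N_V` and asks for the CUT and FAR
letters of `N_V` (`≤ R_N e^{−δd}` into the cube, `≤ θ_F e^{−δd}` out of it).  With the covariant averaging summand `P := a·Q*(U)Q(U) − ∂Π∂* ⊗ 1_ι` (n15-c∕181) the perturbation is
`N_V^Q = a(Q*(1)Q(1) − Q*(U)Q(U)) = a[(Q*(1) − Q*(U))Q(1) + Q*(U)(Q(1) − Q(U))]` (the Landau parts cancel), and everything reduces to the sizes of the transports `T(Γ) − 1` along the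
contours of (125): at most `(d+1)(n−1) + (n−1) < (d+2)n` one-bond factors, each `ρ`-close to `1`, so `‖T(Γ) − 1‖ ≤ (1+ρ)^{(d+2)n} − 1` in max-row-sum AND max-column-sum (the adjoint
transposes the colour kernel) — [Balaban1985Averaging] p. 36: «it has an estimate |(Q₀A)_c| ≤ |A| ≤ α₁»; [Balaban1985BackgroundPropagators] (3.58)–(3.59) p. 401–402 (the averaging
perturbation is `O(α)` and block-local: shape).  In the sequel `ρ = κ_e·2‖U − 1‖ ≲ 2κ_e c₃₅Mα₀·η`, `n = η⁻¹`, so `K ≤ e^{2(d+2)κ_e c₃₅Mα₀} − 1 = O(Mα₀)`: the print's small factor.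

RESULTS ([folklore]; the (1.18)∕(125)∕(3.59) tags mark shapes, nothing printed is asserted).
* §3 the shapes: ★ `hasMaj_qvKer` (rows of the kernel `≤ B` ⟹ `Q_W ≤ B·e^{ρ′}·e^{−ρ′d}` from fine coloured 1-forms blocked by unit blocks into coarse ones blocked by site, EVERY `ρ′ ≥ 0`),
  ★ `hasMaj_qvAdjKer` (columns `≤ B` ⟹ `Q*_W ≤ B·e^{ρ′}·e^{−ρ′d}`) — both operators touch neighbouring blocks only.
* §4 the letters: `hasMaj_qvCov_sub_one`, `hasMaj_qvCovAdj_sub_one` (size `K`), `hasMaj_qvCov`, `hasMaj_qvCovAdj` (size `1 + K`), and ★★ **`hasMaj_nvQ`**: for `δ > 0`,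
  `a·(tensorId ι (Q*∘Q) − Q*(U)∘Q(U)) ≤ |a|·K(2+K)·c_{d+1}(δ)·e^{3δ}·e^{−δ|y−y′|_T}` blockwise (fine → fine), `c_{d+1}(δ)` = Lemma 2.1's row-sum constant `B4Sect5Proof.latticeConst`.

HONEST FRAMING ∕ LIMITS.  Block-majorant bookkeeping for the MODEL object of n15-c∕181 (main term (125) only, one-level staircase contours, abstract transporter matrices `T`); the smallness
`ρ` is a HYPOTHESIS here (the sequel derives it from the small-field class); the `D_U R(U) D*_U` summand of (3.26) is NOT treated (flat on this road; N06's Thms 3.1–3.3 lane); no two-grid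
η-defect yet (LOCATED: the `𝔇(N_V^Q′, N_V^Q)` letter through this seat's g4 `norm_stairProd_two_spacing_le`).  NE2⁺ NOT PRINTED; N15 of record untouched (DISCHARGED AS CONSUMED); counts
UNMOVED (typed 28∕28); one finite 𝕋⁴ at fixed ε per index — NOT infinite volume ∕ OS ∕ mass gap ∕ Clay.  Restate-immune (no Theses import).
-/

noncomputable section

open scoped BigOperators Matrix
open Finset

namespace Summit.QuantumFields.YangMills.BalabanUVNodes.N15.CovAvg

open Literature.MathematicalPhysics.QuantumFieldTheory.Balaban1983to89
open Literature.MathematicalPhysics.QuantumFieldTheory.Balaban1983to89.B11SectG (BlockNorm HasMaj RowSum hasMaj_comp_exp)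
open Literature.MathematicalPhysics.QuantumFieldTheory.Balaban1983to89.B11AxialTransport190 (abs_le_loc_ofBlocks loc_ofBlocks_le)
open Literature.MathematicalPhysics.QuantumFieldTheory.Balaban1983to89.B5Prop11Plancherel (Tor fine unitVec)
open Literature.MathematicalPhysics.QuantumFieldTheory.Balaban1983to89.B6UnitTorusCarrier (unitTorusGeo triangle254_unitTorusGeo rowSum_unitTorusGeo unitTorusGeo_dist_nonneg unitTorusGeo_dist card_fibre_blockOf)
open Literature.MathematicalPhysics.QuantumFieldTheory.Balaban1983to89.T4EtaRateCoeffDefect (fibre mem_fibre)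
open Literature.MathematicalPhysics.QuantumFieldTheory.King1986.Torus (blockOf tdistT tdistT_nonneg tdistT_symm)
open Summit.QuantumFields.YangMills.BalabanUVNodes.N15.VectorPiece (bondAt blockCoords bpt_blockCoords tensorId tensorId_apply)
open Summit.QuantumFields.YangMills.BalabanUVNodes.N15.MatrixSpecies (liftBlk)
open Summit.QuantumFields.YangMills.BalabanUVNodes.N15.TwoGrid (qvRe qvAdjRe tdistT_blockOf_add_smul_le hasMaj_smul_ofBlocks)

variable {d : ℕ}

/-! ## §3 The two shapes are block-local: block majorants from kernel rows ∕ columns -/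

section Shapes

variable {L : ℕ} (M : Fin (d + 1) → ℕ) [∀ μ, NeZero (M μ)] (k n : ℕ) [NeZero n] {ι : Type} [Fintype ι] [DecidableEq ι]

/-- neighbouring blocks cost `e^{ρ′}`: `tdist ≤ 1 ⟹ 1 ≤ e^{ρ′}·e^{−ρ′·tdist}` (`ρ′ ≥ 0`). [folklore] -/
theorem one_le_exp_mul_exp_of_le_one {ρ' t : ℝ} (hρ' : 0 ≤ ρ') (ht : t ≤ 1) : 1 ≤ Real.exp ρ' * Real.exp (-(ρ' * t)) := by
  rw [← Real.exp_add]
  exact Real.one_le_exp (by nlinarith)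

omit [DecidableEq ι] in
/-- ★ **THE AVERAGE SHAPE IS BLOCK-LOCAL**: kernel rows `Σ_j |W p s _{ij}| ≤ B` (`s < n`, `B ≥ 0`) ⟹ `Q_W` has block majorant `B·e^{ρ′}·e^{−ρ′|y−y′|_T}` from fine coloured 1-forms (blocked
by King's unit blocks) into coarse ones (blocked by site), for every `ρ′ ≥ 0` — the line `x + s e_μ`, `s < n`, stays within one block of `B(x)`. [cite: Balaban1984PropagatorsI, (1.18) p.20 (shape)] -/
theorem hasMaj_qvKer {W : Tor (fine n M) × Fin (d + 1) → ℕ → Matrix ι ι ℝ} {B ρ' : ℝ} (hB : 0 ≤ B) (hρ' : 0 ≤ ρ')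
    (hW : ∀ p s, s < n → ∀ i, ∑ j, |W p s i j| ≤ B) :
    HasMaj (BlockNorm.ofBlocks (unitTorusGeo L k M) (liftBlk (fun b : Tor (fine n M) × Fin (d + 1) => blockOf n M b.1) ι))
      (BlockNorm.ofBlocks (unitTorusGeo L k M) (liftBlk (fun b : Tor M × Fin (d + 1) => b.1) ι)) (qvKer M n W)
      (fun y y' => B * Real.exp ρ' * Real.exp (-(ρ' * tdistT M y y'))) := by
  classical
  intro y' μ hμ y
  have hK0 : 0 ≤ B * Real.exp ρ' * Real.exp (-(ρ' * tdistT M y y')) := by positivity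
  have hn : (0 : ℝ) < n := by exact_mod_cast Nat.pos_of_ne_zero (NeZero.ne n)
  refine loc_ofBlocks_le _ _ (mul_nonneg hK0 ((BlockNorm.ofBlocks (unitTorusGeo L k M) (liftBlk (fun b : Tor (fine n M) × Fin (d + 1) => blockOf n M b.1) ι)).loc_nonneg y' μ)) fun q hq => ?_
  obtain ⟨⟨y₀, κ⟩, i⟩ := q
  change y₀ = y at hq
  subst hq
  rw [qvKer_apply]
  -- each (x, s) term is bounded by the constant
  have hterm : ∀ x ∈ fibre (blockOf n M) y₀, ∀ s ∈ range n,
      |∑ j, W (x, κ) s i j * μ ((x + s • unitVec (fine n M) κ, κ), j)| ≤ B * Real.exp ρ' * Real.exp (-(ρ' * tdistT M y₀ y')) * (BlockNorm.ofBlocks (unitTorusGeo L k M) (liftBlk (fun b : Tor (fine n M) × Fin (d + 1) => blockOf n M b.1) ι)).loc y' μ := by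
    intro x hx s hs
    have hsn : s < n := mem_range.mp hs
    by_cases hb : blockOf n M (x + s • unitVec (fine n M) κ) = y'
    · have hxy : blockOf n M x = y₀ := (mem_fibre _ _ _).mp hx
      have hd : tdistT M y₀ y' ≤ 1 := by
        rw [← hxy, ← hb, tdistT_symm]
        exact tdistT_blockOf_add_smul_le M n x κ hsn.le
      calc |∑ j, W (x, κ) s i j * μ ((x + s • unitVec (fine n M) κ, κ), j)|
          ≤ ∑ j, |W (x, κ) s i j| * |μ ((x + s • unitVec (fine n M) κ, κ), j)| :=
            (abs_sum_le_sum_abs _ _).trans (le_of_eq (sum_congr rfl fun j _ => abs_mul _ _))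
        _ ≤ ∑ j, |W (x, κ) s i j| * (BlockNorm.ofBlocks (unitTorusGeo L k M) (liftBlk (fun b : Tor (fine n M) × Fin (d + 1) => blockOf n M b.1) ι)).loc y' μ := sum_le_sum fun j _ =>
            mul_le_mul_of_nonneg_left (abs_le_loc_ofBlocks (g := unitTorusGeo L k M) (liftBlk (fun b : Tor (fine n M) × Fin (d + 1) => blockOf n M b.1) ι) μ
              (x' := ((x + s • unitVec (fine n M) κ, κ), j)) hb) (abs_nonneg _)
        _ = (∑ j, |W (x, κ) s i j|) * (BlockNorm.ofBlocks (unitTorusGeo L k M) (liftBlk (fun b : Tor (fine n M) × Fin (d + 1) => blockOf n M b.1) ι)).loc y' μ := by rw [sum_mul]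
        _ ≤ B * 1 * (BlockNorm.ofBlocks (unitTorusGeo L k M) (liftBlk (fun b : Tor (fine n M) × Fin (d + 1) => blockOf n M b.1) ι)).loc y' μ := by rw [mul_one]; exact mul_le_mul_of_nonneg_right (hW _ s hsn i) ((BlockNorm.ofBlocks (unitTorusGeo L k M) (liftBlk (fun b : Tor (fine n M) × Fin (d + 1) => blockOf n M b.1) ι)).loc_nonneg y' μ)
        _ ≤ B * (Real.exp ρ' * Real.exp (-(ρ' * tdistT M y₀ y'))) * (BlockNorm.ofBlocks (unitTorusGeo L k M) (liftBlk (fun b : Tor (fine n M) × Fin (d + 1) => blockOf n M b.1) ι)).loc y' μ :=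
            mul_le_mul_of_nonneg_right (mul_le_mul_of_nonneg_left (one_le_exp_mul_exp_of_le_one hρ' hd) hB) ((BlockNorm.ofBlocks (unitTorusGeo L k M) (liftBlk (fun b : Tor (fine n M) × Fin (d + 1) => blockOf n M b.1) ι)).loc_nonneg y' μ)
        _ = _ := by ring
    · have h0 : ∀ j, μ ((x + s • unitVec (fine n M) κ, κ), j) = 0 := fun j => hμ _ (by simpa [liftBlk] using hb)
      simp only [h0, mul_zero, sum_const_zero, abs_zero]
      exact mul_nonneg hK0 ((BlockNorm.ofBlocks (unitTorusGeo L k M) (liftBlk (fun b : Tor (fine n M) × Fin (d + 1) => blockOf n M b.1) ι)).loc_nonneg y' μ)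
  -- average of a constant bound
  have hinner : ∀ x ∈ fibre (blockOf n M) y₀, |(n : ℝ)⁻¹ * ∑ s ∈ range n, ∑ j, W (x, κ) s i j * μ ((x + s • unitVec (fine n M) κ, κ), j)|
      ≤ B * Real.exp ρ' * Real.exp (-(ρ' * tdistT M y₀ y')) * (BlockNorm.ofBlocks (unitTorusGeo L k M) (liftBlk (fun b : Tor (fine n M) × Fin (d + 1) => blockOf n M b.1) ι)).loc y' μ := by
    intro x hx
    rw [abs_mul, abs_inv, abs_of_pos hn]
    calc (n : ℝ)⁻¹ * |∑ s ∈ range n, ∑ j, W (x, κ) s i j * μ ((x + s • unitVec (fine n M) κ, κ), j)|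
        ≤ (n : ℝ)⁻¹ * ∑ s ∈ range n, B * Real.exp ρ' * Real.exp (-(ρ' * tdistT M y₀ y')) * (BlockNorm.ofBlocks (unitTorusGeo L k M) (liftBlk (fun b : Tor (fine n M) × Fin (d + 1) => blockOf n M b.1) ι)).loc y' μ :=
          mul_le_mul_of_nonneg_left ((abs_sum_le_sum_abs _ _).trans (sum_le_sum fun s hs => hterm x hx s hs)) (by positivity)
      _ = _ := by rw [sum_const, card_range, nsmul_eq_mul, ← mul_assoc, inv_mul_cancel₀ hn.ne', one_mul]
  rw [abs_mul, abs_inv, abs_of_pos (pow_pos hn _)]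
  calc ((n : ℝ) ^ (d + 1))⁻¹ * |∑ x ∈ fibre (blockOf n M) y₀, (n : ℝ)⁻¹ * ∑ s ∈ range n, ∑ j, W (x, κ) s i j * μ ((x + s • unitVec (fine n M) κ, κ), j)|
      ≤ ((n : ℝ) ^ (d + 1))⁻¹ * ∑ x ∈ fibre (blockOf n M) y₀, B * Real.exp ρ' * Real.exp (-(ρ' * tdistT M y₀ y')) * (BlockNorm.ofBlocks (unitTorusGeo L k M) (liftBlk (fun b : Tor (fine n M) × Fin (d + 1) => blockOf n M b.1) ι)).loc y' μ :=
        mul_le_mul_of_nonneg_left ((abs_sum_le_sum_abs _ _).trans (sum_le_sum fun x hx => hinner x hx)) (by positivity)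
    _ = B * Real.exp ρ' * Real.exp (-(ρ' * tdistT M y₀ y')) * (BlockNorm.ofBlocks (unitTorusGeo L k M) (liftBlk (fun b : Tor (fine n M) × Fin (d + 1) => blockOf n M b.1) ι)).loc y' μ := by
        rw [sum_const, card_fibre_blockOf, nsmul_eq_mul, Nat.cast_pow, ← mul_assoc, inv_mul_cancel₀ (pow_pos hn _).ne', one_mul]

omit [DecidableEq ι] in
/-- ★ **THE ADJOINT SHAPE IS BLOCK-LOCAL**: kernel COLUMNS `Σ_i |W p s _{ij}| ≤ B` (`s < n`, `B ≥ 0`) ⟹ `Q*_W` has block majorant `B·e^{ρ′}·e^{−ρ′|y−y′|_T}` from coarse coloured 1-forms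
(blocked by site) into fine ones (blocked by King's unit blocks), for every `ρ′ ≥ 0`. [cite: Balaban1984PropagatorsI, (1.18) p.20, (1.69) p.29 («Q*»: shape)] -/
theorem hasMaj_qvAdjKer {W : Tor (fine n M) × Fin (d + 1) → ℕ → Matrix ι ι ℝ} {B ρ' : ℝ} (hB : 0 ≤ B) (hρ' : 0 ≤ ρ')
    (hW : ∀ p s, s < n → ∀ j, ∑ i, |W p s i j| ≤ B) :
    HasMaj (BlockNorm.ofBlocks (unitTorusGeo L k M) (liftBlk (fun b : Tor M × Fin (d + 1) => b.1) ι))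
      (BlockNorm.ofBlocks (unitTorusGeo L k M) (liftBlk (fun b : Tor (fine n M) × Fin (d + 1) => blockOf n M b.1) ι)) (qvAdjKer M n W)
      (fun y y' => B * Real.exp ρ' * Real.exp (-(ρ' * tdistT M y y'))) := by
  classical
  intro y' v hv y
  have hK0 : 0 ≤ B * Real.exp ρ' * Real.exp (-(ρ' * tdistT M y y')) := by positivity
  have hn : (0 : ℝ) < n := by exact_mod_cast Nat.pos_of_ne_zero (NeZero.ne n)
  refine loc_ofBlocks_le _ _ (mul_nonneg hK0 ((BlockNorm.ofBlocks (unitTorusGeo L k M) (liftBlk (fun b : Tor M × Fin (d + 1) => b.1) ι)).loc_nonneg y' v)) fun p hp => ?_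
  obtain ⟨⟨x, κ⟩, j⟩ := p
  change blockOf n M x = y at hp
  rw [qvAdjKer_apply]
  have hterm : ∀ s ∈ range n, |∑ i, W (x - s • unitVec (fine n M) κ, κ) s i j * v ((blockOf n M (x - s • unitVec (fine n M) κ), κ), i)|
      ≤ B * Real.exp ρ' * Real.exp (-(ρ' * tdistT M y y')) * (BlockNorm.ofBlocks (unitTorusGeo L k M) (liftBlk (fun b : Tor M × Fin (d + 1) => b.1) ι)).loc y' v := by
    intro s hs
    have hsn : s < n := mem_range.mp hs
    by_cases hb : blockOf n M (x - s • unitVec (fine n M) κ) = y'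
    · have hd : tdistT M y y' ≤ 1 := by
        have h := tdistT_blockOf_add_smul_le M n (x - s • unitVec (fine n M) κ) κ hsn.le
        rw [sub_add_cancel, hp, hb] at h
        exact h
      calc |∑ i, W (x - s • unitVec (fine n M) κ, κ) s i j * v ((blockOf n M (x - s • unitVec (fine n M) κ), κ), i)|
          ≤ ∑ i, |W (x - s • unitVec (fine n M) κ, κ) s i j| * |v ((blockOf n M (x - s • unitVec (fine n M) κ), κ), i)| :=
            (abs_sum_le_sum_abs _ _).trans (le_of_eq (sum_congr rfl fun i _ => abs_mul _ _))
        _ ≤ ∑ i, |W (x - s • unitVec (fine n M) κ, κ) s i j| * (BlockNorm.ofBlocks (unitTorusGeo L k M) (liftBlk (fun b : Tor M × Fin (d + 1) => b.1) ι)).loc y' v := sum_le_sum fun i _ =>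
            mul_le_mul_of_nonneg_left (abs_le_loc_ofBlocks (g := unitTorusGeo L k M) (liftBlk (fun b : Tor M × Fin (d + 1) => b.1) ι) v
              (x' := ((blockOf n M (x - s • unitVec (fine n M) κ), κ), i)) hb) (abs_nonneg _)
        _ = (∑ i, |W (x - s • unitVec (fine n M) κ, κ) s i j|) * (BlockNorm.ofBlocks (unitTorusGeo L k M) (liftBlk (fun b : Tor M × Fin (d + 1) => b.1) ι)).loc y' v := by rw [sum_mul]
        _ ≤ B * 1 * (BlockNorm.ofBlocks (unitTorusGeo L k M) (liftBlk (fun b : Tor M × Fin (d + 1) => b.1) ι)).loc y' v := by rw [mul_one]; exact mul_le_mul_of_nonneg_right (hW _ s hsn j) ((BlockNorm.ofBlocks (unitTorusGeo L k M) (liftBlk (fun b : Tor M × Fin (d + 1) => b.1) ι)).loc_nonneg y' v)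
        _ ≤ B * (Real.exp ρ' * Real.exp (-(ρ' * tdistT M y y'))) * (BlockNorm.ofBlocks (unitTorusGeo L k M) (liftBlk (fun b : Tor M × Fin (d + 1) => b.1) ι)).loc y' v :=
            mul_le_mul_of_nonneg_right (mul_le_mul_of_nonneg_left (one_le_exp_mul_exp_of_le_one hρ' hd) hB) ((BlockNorm.ofBlocks (unitTorusGeo L k M) (liftBlk (fun b : Tor M × Fin (d + 1) => b.1) ι)).loc_nonneg y' v)
        _ = _ := by ring
    · have h0 : ∀ i, v ((blockOf n M (x - s • unitVec (fine n M) κ), κ), i) = 0 := fun i => hv _ (by simpa [liftBlk] using hb)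
      simp only [h0, mul_zero, sum_const_zero, abs_zero]
      exact mul_nonneg hK0 ((BlockNorm.ofBlocks (unitTorusGeo L k M) (liftBlk (fun b : Tor M × Fin (d + 1) => b.1) ι)).loc_nonneg y' v)
  rw [abs_mul, abs_inv, abs_of_pos hn]
  calc (n : ℝ)⁻¹ * |∑ s ∈ range n, ∑ i, W (x - s • unitVec (fine n M) κ, κ) s i j * v ((blockOf n M (x - s • unitVec (fine n M) κ), κ), i)|
      ≤ (n : ℝ)⁻¹ * ∑ s ∈ range n, B * Real.exp ρ' * Real.exp (-(ρ' * tdistT M y y')) * (BlockNorm.ofBlocks (unitTorusGeo L k M) (liftBlk (fun b : Tor M × Fin (d + 1) => b.1) ι)).loc y' v :=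
        mul_le_mul_of_nonneg_left ((abs_sum_le_sum_abs _ _).trans (sum_le_sum fun s hs => hterm s hs)) (by positivity)
    _ = B * Real.exp ρ' * Real.exp (-(ρ' * tdistT M y y')) * (BlockNorm.ofBlocks (unitTorusGeo L k M) (liftBlk (fun b : Tor M × Fin (d + 1) => b.1) ι)).loc y' v := by
        rw [sum_const, card_range, nsmul_eq_mul, ← mul_assoc, inv_mul_cancel₀ hn.ne', one_mul]

end Shapes

/-! ## §4 The letters of `Q(U)`, `Q*(U)` and of the perturbation `N_V^Q = a(Q*(1)Q(1) − Q*(U)Q(U))` -/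

section Letters

variable {L : ℕ} (M : Fin (d + 1) → ℕ) [∀ μ, NeZero (M μ)] (k n : ℕ) [NeZero n] {ι : Type} [Fintype ι] [DecidableEq ι]

/-- ★ `Q(U) − Q(1) ≤ K·e^{ρ′}·e^{−ρ′d}`, `K = (1+ρ)^{(d+2)n} − 1`, for transporters `ρ`-close to `1` in rows. [cite: Balaban1985Averaging, (125)–(126) p.36; Balaban1985BackgroundPropagators, (3.59) p.402 (shape)] -/
theorem hasMaj_qvCov_sub_one {T : Fin (d + 1) → Tor (fine n M) × Fin (d + 1) → Matrix ι ι ℝ} {ρ ρ' : ℝ} (hρ : 0 ≤ ρ) (hρ' : 0 ≤ ρ')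
    (hT : ∀ μ p i, ∑ j, |(T μ p - 1) i j| ≤ ρ) :
    HasMaj (BlockNorm.ofBlocks (unitTorusGeo L k M) (liftBlk (fun b : Tor (fine n M) × Fin (d + 1) => blockOf n M b.1) ι))
      (BlockNorm.ofBlocks (unitTorusGeo L k M) (liftBlk (fun b : Tor M × Fin (d + 1) => b.1) ι)) (qvCov M n T - qvCov M n (fun _ _ => 1))
      (fun y y' => ((1 + ρ) ^ ((d + 2) * n) - 1) * Real.exp ρ' * Real.exp (-(ρ' * tdistT M y y'))) := by
  rw [qvCov_sub_qvCov_one]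
  have hK : 0 ≤ (1 + ρ) ^ ((d + 2) * n) - 1 := by have := one_le_pow₀ (M₀ := ℝ) (a := 1 + ρ) (by linarith) (n := (d + 2) * n); linarith
  exact hasMaj_qvKer M k n hK hρ' fun p s hs i => rows_cvaPath_sub_one_le M n hρ hT p hs.le i

/-- ★ `Q*(U) − Q*(1) ≤ K·e^{ρ′}·e^{−ρ′d}` for transporters `ρ`-close to `1` in columns. [cite: Balaban1985Averaging, (125)–(126) p.36; Balaban1985BackgroundPropagators, (3.59) p.402 (shape)] -/
theorem hasMaj_qvCovAdj_sub_one {T : Fin (d + 1) → Tor (fine n M) × Fin (d + 1) → Matrix ι ι ℝ} {ρ ρ' : ℝ} (hρ : 0 ≤ ρ) (hρ' : 0 ≤ ρ')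
    (hT : ∀ μ p j, ∑ i, |(T μ p - 1) i j| ≤ ρ) :
    HasMaj (BlockNorm.ofBlocks (unitTorusGeo L k M) (liftBlk (fun b : Tor M × Fin (d + 1) => b.1) ι))
      (BlockNorm.ofBlocks (unitTorusGeo L k M) (liftBlk (fun b : Tor (fine n M) × Fin (d + 1) => blockOf n M b.1) ι)) (qvCovAdj M n T - qvCovAdj M n (fun _ _ => 1))
      (fun y y' => ((1 + ρ) ^ ((d + 2) * n) - 1) * Real.exp ρ' * Real.exp (-(ρ' * tdistT M y y'))) := by
  rw [qvCovAdj_sub_qvCovAdj_one]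
  have hK : 0 ≤ (1 + ρ) ^ ((d + 2) * n) - 1 := by have := one_le_pow₀ (M₀ := ℝ) (a := 1 + ρ) (by linarith) (n := (d + 2) * n); linarith
  exact hasMaj_qvAdjKer M k n hK hρ' fun p s hs j => cols_cvaPath_sub_one_le M n hρ hT p hs.le j

/-- `Q(U) ≤ (1+K)·e^{ρ′}·e^{−ρ′d}`. [cite: Balaban1985Averaging, (126) p.36 (shape)] -/
theorem hasMaj_qvCov {T : Fin (d + 1) → Tor (fine n M) × Fin (d + 1) → Matrix ι ι ℝ} {ρ ρ' : ℝ} (hρ : 0 ≤ ρ) (hρ' : 0 ≤ ρ')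
    (hT : ∀ μ p i, ∑ j, |(T μ p - 1) i j| ≤ ρ) :
    HasMaj (BlockNorm.ofBlocks (unitTorusGeo L k M) (liftBlk (fun b : Tor (fine n M) × Fin (d + 1) => blockOf n M b.1) ι))
      (BlockNorm.ofBlocks (unitTorusGeo L k M) (liftBlk (fun b : Tor M × Fin (d + 1) => b.1) ι)) (qvCov M n T)
      (fun y y' => (1 + ρ) ^ ((d + 2) * n) * Real.exp ρ' * Real.exp (-(ρ' * tdistT M y y'))) :=
  hasMaj_qvKer M k n (by positivity) hρ' fun p s hs i => rows_cvaPath_le M n hρ hT p hs.le i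

/-- `Q*(U) ≤ (1+K)·e^{ρ′}·e^{−ρ′d}`. [cite: Balaban1985Averaging, (126) p.36 (shape)] -/
theorem hasMaj_qvCovAdj {T : Fin (d + 1) → Tor (fine n M) × Fin (d + 1) → Matrix ι ι ℝ} {ρ ρ' : ℝ} (hρ : 0 ≤ ρ) (hρ' : 0 ≤ ρ')
    (hT : ∀ μ p j, ∑ i, |(T μ p - 1) i j| ≤ ρ) :
    HasMaj (BlockNorm.ofBlocks (unitTorusGeo L k M) (liftBlk (fun b : Tor M × Fin (d + 1) => b.1) ι))
      (BlockNorm.ofBlocks (unitTorusGeo L k M) (liftBlk (fun b : Tor (fine n M) × Fin (d + 1) => blockOf n M b.1) ι)) (qvCovAdj M n T)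
      (fun y y' => (1 + ρ) ^ ((d + 2) * n) * Real.exp ρ' * Real.exp (-(ρ' * tdistT M y y'))) :=
  hasMaj_qvAdjKer M k n (by positivity) hρ' fun p s hs j => cols_cvaPath_le M n hρ hT p hs.le j

omit [Fintype ι] [DecidableEq ι] in
/-- `tensorId` is multiplicative: `(S∘T) ⊗ 1_ι = (S ⊗ 1_ι)∘(T ⊗ 1_ι)`. [folklore] -/
theorem cva_tensorId_comp {X X₂ X₃ : Type} (S : (X₂ → ℝ) →ₗ[ℝ] (X₃ → ℝ)) (T : (X → ℝ) →ₗ[ℝ] (X₂ → ℝ)) :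
    tensorId ι (S ∘ₗ T) = tensorId ι S ∘ₗ tensorId ι T :=
  LinearMap.ext fun f => funext fun p => by simp only [tensorId_apply, LinearMap.comp_apply]

/-- The perturbation as two products of a small and a bounded factor: `Q*(1)Q(1) − Q*(U)Q(U) = (Q*(1) − Q*(U))∘Q(1) + Q*(U)∘(Q(1) − Q(U))`. [folklore] -/
theorem adj_comp_sub_adj_comp (T : Fin (d + 1) → Tor (fine n M) × Fin (d + 1) → Matrix ι ι ℝ) :
    qvCovAdj M n (fun _ _ => 1) ∘ₗ qvCov M n (fun _ _ => 1) - qvCovAdj M n T ∘ₗ qvCov M n T =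
      (qvCovAdj M n (fun _ _ => 1) - qvCovAdj M n T) ∘ₗ qvCov M n (fun _ _ => 1) + qvCovAdj M n T ∘ₗ (qvCov M n (fun _ _ => 1) - qvCov M n T) := by
  rw [LinearMap.sub_comp, LinearMap.comp_sub]; abel

/-- ★★ **THE LETTER OF THE AVERAGING PERTURBATION `N_V^Q = a·(Q*Q ⊗ 1_ι − Q*(U)Q(U))`**: for transporters `ρ`-close to `1` in rows and columns and `δ > 0`, the block-local operator
`a·(tensorId ι (qvAdjRe ∘ qvRe) − Q*_T ∘ Q_T)` has the block majorant `|a|·K(2+K)·c_{d+1}(δ)·e^{3δ}·e^{−δ|y−y′|_T}` from fine coloured 1-forms into themselves, `K = (1+ρ)^{(d+2)n} − 1`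
(`c_{d+1}(δ) = B4Sect5Proof.latticeConst (d+1) δ`, Lemma 2.1's row sum). [cite: Balaban1985BackgroundPropagators, (3.59)–(3.60) p.402 (the averaging words are `O(α)·a` and block-local: shape); Balaban1984PropagatorsII, Lemma 2.1 (2.61) p.234] -/
theorem hasMaj_nvQ {T : Fin (d + 1) → Tor (fine n M) × Fin (d + 1) → Matrix ι ι ℝ} {ρ δ : ℝ} (hρ : 0 ≤ ρ) (hδ : 0 < δ)
    (hTr : ∀ μ p i, ∑ j, |(T μ p - 1) i j| ≤ ρ) (hTc : ∀ μ p j, ∑ i, |(T μ p - 1) i j| ≤ ρ) (a : ℝ) :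
    HasMaj (BlockNorm.ofBlocks (unitTorusGeo L k M) (liftBlk (fun b : Tor (fine n M) × Fin (d + 1) => blockOf n M b.1) ι))
      (BlockNorm.ofBlocks (unitTorusGeo L k M) (liftBlk (fun b : Tor (fine n M) × Fin (d + 1) => blockOf n M b.1) ι))
      (a • (tensorId ι (qvAdjRe M n ∘ₗ qvRe M n) - qvCovAdj M n T ∘ₗ qvCov M n T))
      (fun y y' => |a| * (((1 + ρ) ^ ((d + 2) * n) - 1) * (2 + ((1 + ρ) ^ ((d + 2) * n) - 1)) * (B4Sect5Proof.latticeConst (d + 1) δ * Real.exp (3 * δ))) *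
        Real.exp (-(δ * tdistT M y y'))) := by
  set K : ℝ := (1 + ρ) ^ ((d + 2) * n) - 1 with hKdef
  set c : ℝ := B4Sect5Proof.latticeConst (d + 1) δ with hcdef
  have hK : 0 ≤ K := by have := one_le_pow₀ (M₀ := ℝ) (a := 1 + ρ) (by linarith) (n := (d + 2) * n); rw [hKdef]; linarith
  have hc : 0 ≤ c := B4Sect5Proof.latticeConst_nonneg (d + 1) hδ.le
  have hrow : RowSum (unitTorusGeo L k M) δ c := rowSum_unitTorusGeo L k M hδ
  have h2δ : (0 : ℝ) ≤ 2 * δ := by linarith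
  -- the flat pair is the covariant pair at `T ≡ 1`
  have hflat : tensorId ι (qvAdjRe M n ∘ₗ qvRe M n) = qvCovAdj M n (fun _ _ => 1) ∘ₗ qvCov M n (fun _ _ => 1) := by
    rw [cva_tensorId_comp, qvCov_one, qvCovAdj_one]
  rw [hflat, adj_comp_sub_adj_comp]
  -- first word: (Q*(1) − Q*(U)) ∘ Q(1)
  have hA : HasMaj (BlockNorm.ofBlocks (unitTorusGeo L k M) (liftBlk (fun b : Tor M × Fin (d + 1) => b.1) ι))
      (BlockNorm.ofBlocks (unitTorusGeo L k M) (liftBlk (fun b : Tor (fine n M) × Fin (d + 1) => blockOf n M b.1) ι))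
      (qvCovAdj M n (fun _ _ => (1 : Matrix ι ι ℝ)) - qvCovAdj M n T) (fun y y' => K * Real.exp (2 * δ) * Real.exp (-(2 * δ * tdistT M y y'))) := by
    have h := (hasMaj_qvCovAdj_sub_one (L := L) M k n hρ h2δ hTc (T := T)).neg
    rw [neg_sub] at h
    exact h
  have hB : HasMaj (BlockNorm.ofBlocks (unitTorusGeo L k M) (liftBlk (fun b : Tor (fine n M) × Fin (d + 1) => blockOf n M b.1) ι))
      (BlockNorm.ofBlocks (unitTorusGeo L k M) (liftBlk (fun b : Tor M × Fin (d + 1) => b.1) ι))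
      (qvCov M n (fun _ _ => (1 : Matrix ι ι ℝ))) (fun y y' => 1 * Real.exp δ * Real.exp (-(δ * tdistT M y y'))) := by
    have h := hasMaj_qvCov (L := L) M k n (T := fun _ _ => (1 : Matrix ι ι ℝ)) (ρ := 0) le_rfl hδ.le (fun μ p i => by simp)
    simpa only [add_zero, one_pow] using h
  have h1 := hasMaj_comp_exp (ρ₁ := 2 * δ) (ρ₂ := δ) (ρ := δ) (σ := δ) (triangle254_unitTorusGeo L k M) (unitTorusGeo_dist_nonneg L k M) hrow
    (by positivity) (by positivity) hδ.le le_rfl (by linarith) hA hB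
  -- second word: Q*(U) ∘ (Q(1) − Q(U))
  have hC : HasMaj (BlockNorm.ofBlocks (unitTorusGeo L k M) (liftBlk (fun b : Tor M × Fin (d + 1) => b.1) ι))
      (BlockNorm.ofBlocks (unitTorusGeo L k M) (liftBlk (fun b : Tor (fine n M) × Fin (d + 1) => blockOf n M b.1) ι))
      (qvCovAdj M n T) (fun y y' => (1 + K) * Real.exp (2 * δ) * Real.exp (-(2 * δ * tdistT M y y'))) := by
    have h := hasMaj_qvCovAdj (L := L) M k n hρ h2δ hTc (T := T)
    rwa [show (1 + ρ) ^ ((d + 2) * n) = 1 + K by rw [hKdef]; ring] at h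
  have hD : HasMaj (BlockNorm.ofBlocks (unitTorusGeo L k M) (liftBlk (fun b : Tor (fine n M) × Fin (d + 1) => blockOf n M b.1) ι))
      (BlockNorm.ofBlocks (unitTorusGeo L k M) (liftBlk (fun b : Tor M × Fin (d + 1) => b.1) ι))
      (qvCov M n (fun _ _ => (1 : Matrix ι ι ℝ)) - qvCov M n T) (fun y y' => K * Real.exp δ * Real.exp (-(δ * tdistT M y y'))) := by
    have h := (hasMaj_qvCov_sub_one (L := L) M k n hρ hδ.le hTr (T := T)).neg
    rw [neg_sub] at h
    exact h
  have h2 := hasMaj_comp_exp (ρ₁ := 2 * δ) (ρ₂ := δ) (ρ := δ) (σ := δ) (triangle254_unitTorusGeo L k M) (unitTorusGeo_dist_nonneg L k M) hrow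
    (by positivity) (by positivity) hδ.le le_rfl (by linarith) hC hD
  have hκ : (BlockNorm.ofBlocks (unitTorusGeo L k M) (liftBlk (fun b : Tor M × Fin (d + 1) => b.1) ι)).κ = 1 := rfl
  refine (hasMaj_smul_ofBlocks _ (fun y y' => ?_) a (h1.add h2)).mono fun y y' => ?_
  · rw [hκ]
    exact add_nonneg
      (mul_nonneg (mul_nonneg (mul_nonneg (mul_nonneg zero_le_one (mul_nonneg hK (Real.exp_nonneg _))) (mul_nonneg zero_le_one (Real.exp_nonneg _))) hc)
        (Real.exp_nonneg _))
      (mul_nonneg (mul_nonneg (mul_nonneg (mul_nonneg zero_le_one (mul_nonneg (by linarith) (Real.exp_nonneg _))) (mul_nonneg hK (Real.exp_nonneg _))) hc)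
        (Real.exp_nonneg _))
  · rw [hκ]
    have he : Real.exp (3 * δ) = Real.exp (2 * δ) * Real.exp δ := by rw [← Real.exp_add]; ring_nf
    rw [he]
    apply le_of_eq
    ring

end Letters

end Summit.QuantumFields.YangMills.BalabanUVNodes.N15.CovAvg

end
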